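import Summits.NavierStokesRegularity.NavierStokesRegularity.Theorems.RellichScarSymmetricScarExistsRdssPineauVicolCorners
import Summits.NavierStokesRegularity.NavierStokesRegularity.Theorems.DssFarFieldSlavingBlowupTypeIDssProfileClassToProfile
import Literature.Analysis.FluidPDE.PineauVicolRDSSLiouvilleHolds
import Literature.Analysis.FluidPDE.PineauVicolRSSHolds
import HarnessLib

/-!
# Pineau–Vicol's corners at the CLASS level (route `DssFarFieldSlaving`, crux `BlowupTypeIDssProfile`,
  stmt-NavierStokesRegularity-0155 — SUPPORT; cell pub-ns-dss, lead A54 item (3) "class-level PV transfer")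

Pineau–Vicol 2026 Thm 1.4 / Thm 1.7 (tree, DISCHARGED: `pineauVicol2026_rss_liouville_holds`,
`pineauVicol2026_rdss_liouville_holds`) are stated for CLASSICAL solutions on `ℝ³ × [−1, 0)` written as
the rotated (discretely) self-similar ansatz `pvAnsatz α U` of a `C²` profile.  This file transfers
them to the duality-form class of the crux (ancient mild `ν = 1`, measurable slices, rotated `c`-DSS,
Type-I constant `M`) at the SAME constant:

* `screwInvariant_of_isRotatedDSS` — rotated `c`-DSS with twist `rotZLIE (−θ)` is invariance under the
  screw `conjZ θ ∘ nsRescale c` of the tree's periodic-profile dictionary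
  (`SymmetricScarExists.RdssSplit.PineauVicol.exists_periodicProfile_of_screwInvariant`: a jointly smooth
  screw-invariant field IS `pvAnsatz α U` with `α = θ/(2 log c)` and a `C^∞`, `2 log c`-periodic `U`);
* `rdssClass_pineauVicol_slow` (Thm 1.7 (i), class level): for every `M > 0` there are `α₁ > 0`,
  `c₁ > 1` such that every class member with twist `rotZLIE (−θ)`, factor `1 < c < c₁` and
  `|θ/(2 log c)| ≤ α₁` is a.e. zero on every slice;
* `rdssClass_pineauVicol_fast` (Thm 1.7 (ii), class level): the same with `α₂ ≤ |θ/(2 log c)|` and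
  `c < c₂ ^ (1/(1+(θ/(2 log c))²))`;
* `rdssClass_pineauVicol_rss` (Thm 1.4, class level): a class member (at constant `M`) which is
  pointwise the RSS ansatz `pvAnsatz α (fun y _ => U y)` of a continuous profile on `t < 0` has
  `U = 0` when `|α| < α₁(M)` or `|α| > α₂(M)`.

Route: the classical representative on the whole past at the same constant
(`rdssClass_classicalRepresentative` / `typeI_ancient_classicalRepresentative`), the periodic-profile
dictionary, the discharged Pineau–Vicol theorem on the window `[−1, 0)`, periodicity to all `s`, the
ansatz back to `V`, a.e. to `u`.  All thresholds remain the bare existentials of the source (no number).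

## References

* B. Pineau, V. Vicol, arXiv:2607.09619 (2026), (1.7), (1.13a–b), Thm 1.4 (p. 4), Thm 1.7 (p. 7). [PineauVicol2026]
* G. Koch, N. Nadirashvili, G. Seregin, V. Šverák, Acta Math. 203 (2009), §4. [KochNadirashviliSereginSverak2009]
-/

noncomputable section

set_option linter.dupNamespace false

namespace Summit.NavierStokesRegularity.NavierStokesRegularity.Theorems

open MeasureTheory Set Function Literature.Analysis.FluidPDE
open Summit.NavierStokesRegularity.NavierStokesRegularity.Theorems.SymmetricScarExists.Negative (conjZ)
open Summit.NavierStokesRegularity.NavierStokesRegularity.Theorems.SymmetricScarExists.RdssSplit.PineauVicol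
  (exists_periodicProfile_of_screwInvariant)

/-- **Rotated DSS with twist `R_{−θ}` is screw invariance** `R_θ (c V(c²t, c R_{−θ} x)) = V(t, x)`
(the tree's `IsRotatedDSS c (rotZLIE (−θ)) V` versus the `conjZ θ ∘ nsRescale c` form of the
periodic-profile dictionary; pure rewriting). [cite: PineauVicol2026, (1.13a)–(1.13b) (arXiv:2607.09619 p. 7)] -/
theorem screwInvariant_of_isRotatedDSS {c θ : ℝ}
    {V : ℝ → EuclideanSpace ℝ (Fin 3) → EuclideanSpace ℝ (Fin 3)} (h : IsRotatedDSS c (rotZLIE (-θ)) V) :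
    ∀ t : ℝ, t < 0 → ∀ x : EuclideanSpace ℝ (Fin 3), conjZ θ (nsRescale c V) t x = V t x := by
  intro t _ x
  have key := h t x
  rw [rotZLIE_symm_apply, neg_neg, rotZLIE_apply] at key
  show rotZ θ (c • V (c ^ 2 * t) (c • rotZ (-θ) x)) = V t x
  rw [← key, ← rotZLIE_apply θ, ← rotZLIE_apply θ, LinearIsometryEquiv.map_smul]

/-- A `2 log c`-periodic profile vanishing on one period `[0, 2 log c]` vanishes everywhere (`c > 1`). -/
theorem profile_eq_zero_of_periodic {c : ℝ} (hc : 1 < c)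
    {U : EuclideanSpace ℝ (Fin 3) → ℝ → EuclideanSpace ℝ (Fin 3)}
    (hper : ∀ (y : EuclideanSpace ℝ (Fin 3)) (s : ℝ), U y (s + 2 * Real.log c) = U y s)
    (h0 : ∀ (y : EuclideanSpace ℝ (Fin 3)), ∀ s ∈ Icc (0 : ℝ) (2 * Real.log c), U y s = 0)
    (y : EuclideanSpace ℝ (Fin 3)) (s : ℝ) : U y s = 0 := by
  have hP : 0 < 2 * Real.log c := by have := Real.log_pos hc; positivity
  have hp : Function.Periodic (fun σ => U y σ) (2 * Real.log c) := fun σ => hper y σ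
  obtain ⟨s', hs', hss'⟩ := hp.exists_mem_Ico₀ hP s
  rw [show U y s = U y s' from hss']
  exact h0 y s' (Ico_subset_Icc_self hs')

/-- The ansatz of a vanishing profile vanishes. -/
theorem pvAnsatz_eq_zero_of_profile {α : ℝ} {U : EuclideanSpace ℝ (Fin 3) → ℝ → EuclideanSpace ℝ (Fin 3)}
    (hU : ∀ y s, U y s = 0) (t : ℝ) (x : EuclideanSpace ℝ (Fin 3)) : pvAnsatz α U t x = 0 := by
  unfold pvAnsatz
  rw [hU, ← rotZLIE_apply, map_zero, smul_zero]

/-- **Pineau–Vicol Thm 1.7 (i) at the CLASS level (small angular speed, factor near `1`).**  For every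
`M > 0` there are `α₁ > 0`, `c₁ > 1` such that every ancient mild solution (`ν = 1`) with measurable
slices, Type-I constant `M`, rotated `c`-DSS with twist `R_{−θ}` (`IsRotatedDSS c (rotZLIE (−θ)) u`),
`1 < c < c₁` and `|θ / (2 log c)| ≤ α₁`, is a.e. zero on every slice `t < 0`.  Thresholds = the
source's existentials (ineffective here). [cite: PineauVicol2026, Theorem 1.7 (arXiv:2607.09619 p. 7)] -/
theorem rdssClass_pineauVicol_slow {M : ℝ} (hM : 0 < M) :
    ∃ α₁ c₁ : ℝ, 0 < α₁ ∧ 1 < c₁ ∧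
      ∀ (c θ : ℝ) (u : ℝ → EuclideanSpace ℝ (Fin 3) → EuclideanSpace ℝ (Fin 3)),
        1 < c → c < c₁ → |θ / (2 * Real.log c)| ≤ α₁ →
        IsAncientMildSolution 1 u → (∀ t < 0, AEStronglyMeasurable (u t) volume) →
        IsRotatedDSS c (rotZLIE (-θ)) u → HasTypeIDecay M u → ∀ t < 0, u t =ᵐ[volume] 0 := by
  obtain ⟨⟨α₁, c₁, hα₁, hc₁, H⟩, -⟩ := pineauVicol2026_rdss_liouville_holds M hM
  refine ⟨α₁, c₁, hα₁, hc₁, fun c θ u hc hlt hα hu hmeas hdss hdec t ht => ?_⟩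
  obtain ⟨V, P, -, hP, hR, hVdec, hVu, -⟩ := rdssClass_classicalRepresentative hc hu hmeas hdss hdec
  obtain ⟨U, hUs, hUper, hans⟩ :=
    exists_periodicProfile_of_screwInvariant hc hP.smooth_velocity (screwInvariant_of_isRotatedDSS hR)
  have hsol : IsClassicalNSSolutionOn (Ico (-1) 0) 1 0 V P :=
    hP.mono (fun s hs => hs.2) (uniqueDiffOn_Ico _ _)
  have hU0 := H (θ / (2 * Real.log c)) c V P U hα hc hlt hsol
    (fun s hs x => hVdec s hs.2 x) (hUs.of_le (by norm_cast)) hUper (fun s hs x => hans s hs.2 x)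
  have hUz : ∀ y s, U y s = 0 := profile_eq_zero_of_periodic hc hUper hU0
  have hVt : V t = 0 := funext fun x => by
    rw [Pi.zero_apply, hans t ht x, pvAnsatz_eq_zero_of_profile hUz]
  have key := hVu t ht
  rw [hVt] at key
  exact key.symm

/-- **Pineau–Vicol Thm 1.7 (ii) at the CLASS level (large angular speed, factor below
`c₂ ^ (1/(1+α²))`).** [cite: PineauVicol2026, Theorem 1.7 (arXiv:2607.09619 p. 7)] -/
theorem rdssClass_pineauVicol_fast {M : ℝ} (hM : 0 < M) :
    ∃ α₂ c₂ : ℝ, 0 < α₂ ∧ 1 < c₂ ∧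
      ∀ (c θ : ℝ) (u : ℝ → EuclideanSpace ℝ (Fin 3) → EuclideanSpace ℝ (Fin 3)),
        1 < c → α₂ ≤ |θ / (2 * Real.log c)| →
        c < c₂ ^ (1 / (1 + (θ / (2 * Real.log c)) ^ 2)) →
        IsAncientMildSolution 1 u → (∀ t < 0, AEStronglyMeasurable (u t) volume) →
        IsRotatedDSS c (rotZLIE (-θ)) u → HasTypeIDecay M u → ∀ t < 0, u t =ᵐ[volume] 0 := by
  obtain ⟨-, ⟨α₂, c₂, hα₂, hc₂, H⟩⟩ := pineauVicol2026_rdss_liouville_holds M hM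
  refine ⟨α₂, c₂, hα₂, hc₂, fun c θ u hc hα hlt hu hmeas hdss hdec t ht => ?_⟩
  obtain ⟨V, P, -, hP, hR, hVdec, hVu, -⟩ := rdssClass_classicalRepresentative hc hu hmeas hdss hdec
  obtain ⟨U, hUs, hUper, hans⟩ :=
    exists_periodicProfile_of_screwInvariant hc hP.smooth_velocity (screwInvariant_of_isRotatedDSS hR)
  have hsol : IsClassicalNSSolutionOn (Ico (-1) 0) 1 0 V P :=
    hP.mono (fun s hs => hs.2) (uniqueDiffOn_Ico _ _)
  have hU0 := H (θ / (2 * Real.log c)) c V P U hα hc hlt hsol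
    (fun s hs x => hVdec s hs.2 x) (hUs.of_le (by norm_cast)) hUper (fun s hs x => hans s hs.2 x)
  have hUz : ∀ y s, U y s = 0 := profile_eq_zero_of_periodic hc hUper hU0
  have hVt : V t = 0 := funext fun x => by
    rw [Pi.zero_apply, hans t ht x, pvAnsatz_eq_zero_of_profile hUz]
  have key := hVu t ht
  rw [hVt] at key
  exact key.symm

/-- **Pineau–Vicol Thm 1.4 at the CLASS level (rotated SELF-similar members).**  For every `M > 0`
there are `α₁, α₂ > 0` such that: if an ancient mild solution (`ν = 1`) with measurable slices and
Type-I constant `M` is, pointwise on `t < 0`, the RSS ansatz `pvAnsatz α (fun y _ => U y)` of a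
CONTINUOUS profile `U`, and `|α| < α₁` or `|α| > α₂`, then `U = 0`.  (The `C²` regularity PV assume
is automatic: `U` is the slice at `t = −1` of the smooth representative.)
[cite: PineauVicol2026, Theorem 1.4 (arXiv:2607.09619 p. 4)] -/
theorem rdssClass_pineauVicol_rss {M : ℝ} (hM : 0 < M) :
    ∃ α₁ α₂ : ℝ, 0 < α₁ ∧ 0 < α₂ ∧
      ∀ (α : ℝ) (u : ℝ → EuclideanSpace ℝ (Fin 3) → EuclideanSpace ℝ (Fin 3))
        (U : EuclideanSpace ℝ (Fin 3) → EuclideanSpace ℝ (Fin 3)),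
        IsAncientMildSolution 1 u → (∀ t < 0, AEStronglyMeasurable (u t) volume) → HasTypeIDecay M u →
        Continuous U → (∀ t < 0, ∀ x, u t x = pvAnsatz α (fun y _ => U y) t x) →
        (|α| < α₁ ∨ α₂ < |α|) → U = 0 := by
  obtain ⟨α₁, α₂, hα₁, hα₂, H⟩ := pineauVicol2026_rss_liouville_holds M hM
  refine ⟨α₁, α₂, hα₁, hα₂, fun α u U hu hmeas hdec hUc hans hα => ?_⟩
  obtain ⟨V, P, -, hP, hVdec, hVu, -⟩ := typeI_ancient_classicalRepresentative hu hmeas hdec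
  -- the slices of `u` are continuous (ansatz of a continuous profile), so `V t = u t` on `t < 0`
  have huc : ∀ t < 0, Continuous (u t) := fun t ht => by
    have e : u t = fun x => pvAnsatz α (fun y _ => U y) t x := funext (hans t ht)
    rw [e]
    have hrot : ∀ φ : ℝ, Continuous (rotZ φ) := fun φ => (rotZLIE φ).continuous
    simp only [pvAnsatz]
    exact ((hrot _).comp (hUc.comp ((hrot _).comp
      (continuous_const_smul ((Real.sqrt (-t))⁻¹ : ℝ))))).const_smul ((Real.sqrt (-t))⁻¹ : ℝ)
  have hVeq : ∀ t < 0, V t = u t := fun t ht =>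
    Measure.eq_of_ae_eq (hVu t ht) (continuous_slice_of_isClassicalNSSolutionOn_Iio hP ht) (huc t ht)
  have hsol : IsClassicalNSSolutionOn (Ico (-1) 0) 1 0 V P :=
    hP.mono (fun s hs => hs.2) (uniqueDiffOn_Ico _ _)
  -- `U` is the smooth slice `V (-1)`
  have hUV : U = V (-1) := by
    funext y
    rw [hVeq (-1) (by norm_num), hans (-1) (by norm_num), pvAnsatz_neg_one]
  have hU2 : ContDiff ℝ 2 U := by
    rw [hUV]
    exact (hP.contDiff_velocity (show (-1 : ℝ) ∈ Iio 0 by norm_num)).of_le (by norm_cast)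
  exact H α V P U hsol (fun s hs x => hVdec s hs.2 x) hU2
    (fun s hs x => by rw [hVeq s hs.2]; exact hans s hs.2 x) hα

end Summit.NavierStokesRegularity.NavierStokesRegularity.Theorems

end
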